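import Literature.Computability.AlgebraicComplexity.LaserFormatMethod
import Literature.Computability.AlgebraicComplexity.BigCwSquareValue112
import HarnessLib

/-!
# The format value of the component `[112]` of `CW_q^{⊗2}` (Coppersmith 1997 §3; Coppersmith–Winograd 1990 §8 in format currency) — proved

Topic `Literature/Computability/AlgebraicComplexity`.  In the rectangular analyses of
`CW_q ⊗ CW_q` (Coppersmith 1997 §3, `α > 0.294`; Huang–Pan 1998 §3; Le Gall 2012 §3–§4) the merged
component `T^{[112]}` of the coarse decomposition (labels `0,…,4`, `BigCwSquareComponents.lean`) is
not a matrix product; as in the square case (`BigCwSquareValue112.lean`, the VALUE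
`V_τ([112]) ≥ 2^{2/3} q^τ (q^{3τ}+2)^{1/3}` by an inner laser step on its four pair components) it is
handled by a second application of the laser method — here in the FORMAT currency of
`LaserFormatValue.lean` / `LaserFormatMethod.lean`, where no cyclic symmetrisation is available
(formats are not invariant under it) and the count is governed by `min_m H(P_m)`.

Proved here (everything; no named facts; two small definitions = the explicit format data):

* `PolyDegeneratesTo.rotate_modes`, `HasFormatValue.rotate_modes` — degeneration and format values are
  compatible with the cyclic rotation of the three modes (formats rotate `(A,B,C) ↦ (B,C,A)`);
* `hasFormatValue_cwComp011/101/110/002/020/200` — the level-1 pieces of `CW_q` are worth one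
  product of format `(1,q,1)`, `(1,1,q)`, `(q,1,1)`, `(1,1,1)` (from `BigCwComponents`);
* `hasFormatValue_cwS112` — the four pair components of `[112]` (`T_{110}⊗T_{002}`, `T_{002}⊗T_{110}`
  of format `(q,1,1)`; `T_{101}⊗T_{011}`, `T_{011}⊗T_{101}` of format `(1,q,q)`), via
  `cwSqComp_pair` and `HasFormatValue.kronecker`;
* **`hasFormatValue_cwSqComp112`** — for `q ≥ 1` and rational `σ = a/d ∈ (0,1)`:
  `T^{[112]}` is worth `2^{min(1, H_Z(σ))}` products of format `(q^{1−σ}, q^{σ}, q^{σ})`, where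
  `H_Z(σ) = (2η((1−σ)/2) + η(σ))/ln 2 = (1−σ) + H₂(σ)` bits is the entropy of the `z`-marginal of
  Coppersmith–Winograd's distribution `cwP112 σ` (the `x`- and `y`-marginals have entropy `1`,
  `Γ = 0`: `BigCwSquareValue112`); and its rotations `hasFormatValue_cwSqComp121`
  (format `(q^σ, q^σ, q^{1−σ})`), `hasFormatValue_cwSqComp211` (format `(q^σ, q^{1−σ}, q^σ)`).

This is the inner step of the rectangular `CW_q^{⊗2}` analysis ("layer T", part 3a, of the
`MatrixMultiplication` route `SaturationLadder`); the outer step (a rectangular design on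
`cwSupport₂`) is a separate file.

## References

* D. Coppersmith, S. Winograd, J. Symbolic Comput. 9 (1990), §8. [CoppersmithWinograd1990]
* D. Coppersmith, *Rectangular matrix multiplication revisited*, J. Complexity 13 (1997), §3.
  [Coppersmith1997]
* F. Le Gall, FOCS 2012, arXiv:1204.1111, §3–§4. [LeGall2012]
* M. Bläser, *Fast Matrix Multiplication*, Theory of Computing Graduate Surveys 5 (2013), §5.1,
  Lemma 5.5. [Blaser2013]
-/

set_option autoImplicit false
set_option linter.style.longLine false
set_option linter.unusedSectionVars false
set_option linter.unusedVariables false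

noncomputable section

open Finset Real
open scoped BigOperators

universe u

namespace Literature.Computability.AlgebraicComplexity

open Literature.Barriers.MatrixMultiplication

/-! ## Rotation of the modes -/

section Rotate

variable {K : Type u} [Field K]
variable {ι κ μ ι' κ' μ' : Type*} [Fintype ι] [Fintype κ] [Fintype μ] [Fintype ι'] [Fintype κ']
  [Fintype μ'] [DecidableEq ι] [DecidableEq κ] [DecidableEq μ]

omit [Fintype ι'] [Fintype κ'] [Fintype μ'] [DecidableEq ι] [DecidableEq κ] [DecidableEq μ] in
/-- **Degeneration commutes with the cyclic rotation of the modes**: `t ⊵ s ⇒ t_C ⊵ s_C`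
(rotate the three substitution maps). [cite: Blaser2013, §5.1] -/
theorem _root_.Literature.Barriers.MatrixMultiplication.PolyDegeneratesTo.rotate_modes
    {t : ι → κ → μ → K} {s : ι' → κ' → μ' → K} (h : PolyDegeneratesTo t s) :
    PolyDegeneratesTo (rotate t) (rotate s) := by
  obtain ⟨h, A, B, C, hd⟩ := h
  refine ⟨h, B, C, A, fun b' c' a' j hj => ?_⟩
  have e : (∑ b, ∑ c, ∑ a, Polynomial.C (rotate t b c a) * (B b b' * C c c' * A a a')) =
      ∑ a, ∑ b, ∑ c, Polynomial.C (t a b c) * (A a a' * B b b' * C c c') := by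
    rw [Finset.sum_congr rfl fun b _ => Finset.sum_comm, Finset.sum_comm]
    refine Finset.sum_congr rfl fun a _ => Finset.sum_congr rfl fun b _ =>
      Finset.sum_congr rfl fun c _ => ?_
    rw [rotate_apply]; ring
  rw [e, hd a' b' c' j hj, rotate_apply]

omit [Field K] [Fintype ι] [Fintype κ] [Fintype μ] [Fintype ι'] [Fintype κ'] [Fintype μ']
  [DecidableEq ι] [DecidableEq κ] [DecidableEq μ] in
/-- `rotate (t^{⊗N}) = (rotate t)^{⊗N}`. [folklore] -/
private theorem rotate_kroneckerPow_modes [CommSemiring K] (t : ι → κ → μ → K) (N : ℕ) :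
    rotate (kroneckerPow t N) = kroneckerPow (rotate t) N := by
  funext b c a; simp [rotate_apply, kroneckerPow_apply]

omit [Field K] [Fintype ι] [Fintype κ] [Fintype μ] [Fintype ι'] [Fintype κ'] [Fintype μ']
  [DecidableEq ι] [DecidableEq κ] [DecidableEq μ] in
/-- `rotate (s ⊗ t) = rotate s ⊗ rotate t`. [folklore] -/
private theorem rotate_kronecker_modes [CommSemiring K] (s : ι → κ → μ → K)
    (t : ι' → κ' → μ' → K) :
    rotate (kroneckerTensor s t) = kroneckerTensor (rotate s) (rotate t) := rfl

omit [Fintype ι] [Fintype κ] [Fintype μ] [Fintype ι'] [Fintype κ'] [Fintype μ']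
  [DecidableEq ι] [DecidableEq κ] [DecidableEq μ] in
/-- `rotate ⟨n⟩ = ⟨n⟩`. [folklore] -/
private theorem rotate_unitTensor_modes (n : ℕ) : rotate (unitTensor K n) = unitTensor K n := by
  funext b c a
  simp only [rotate_apply, unitTensor_apply]
  exact if_congr ⟨fun ⟨h1, h2⟩ => ⟨h2, (h1.trans h2).symm⟩, fun ⟨h1, h2⟩ => ⟨(h1.trans h2).symm, h1⟩⟩
    rfl rfl

omit [Fintype ι'] [Fintype κ'] [Fintype μ'] [DecidableEq ι] [DecidableEq κ] [DecidableEq μ] in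
/-- **Format values rotate with the modes**: if `t` is worth `v` products of format `(A,B,C)` then
`t_C` is worth `v` products of format `(B,C,A)` (`rotate ⟨X,Y,Z⟩ ≥ ⟨Y,Z,X⟩`, Bläser Lemma 5.5;
degeneration commutes with rotation). [cite: Blaser2013, Lemma 5.5] [cite: LeGall2012, §3] -/
theorem HasFormatValue.rotate_modes {t : ι → κ → μ → K} {v A B C : ℝ}
    (h : HasFormatValue t v A B C) : HasFormatValue (rotate t) v B C A := by
  intro ε hε
  obtain ⟨N, hN, p, X, Y, Z, hdeg, hv, hA, hB, hC⟩ := h ε hε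
  refine ⟨N, hN, p, Y, Z, X, ?_, hv, hB, hC, hA⟩
  have h1 : PolyDegeneratesTo (Literature.Computability.AlgebraicComplexity.kroneckerPow (rotate t) N)
      (rotate (kroneckerTensor (unitTensor K p) (matMulTensor K X Y Z))) := by
    rw [← rotate_kroneckerPow_modes]; exact hdeg.rotate_modes
  refine h1.trans_restrictsTo ?_
  rw [rotate_kronecker_modes, rotate_unitTensor_modes]
  exact (TensorRestrictsTo.refl _).kronecker (tensorRestrictsTo_rotate_matMulTensor K X Y Z)

end Rotate

/-! ## Format values of the level-1 pieces of `CW_q` -/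

section LevelOne

variable (K : Type u) [Field K] (q : ℕ)

/-- `T_{011} ≥ ⟨1,q,1⟩`: one product of format `(1,q,1)`. [cite: CoppersmithWinograd1990, §7 eq. (10)] -/
theorem hasFormatValue_cwComp011 : HasFormatValue (cwComp K q 0 1 1) 1 1 q 1 := by
  simpa using (hasFormatValue_matMulTensor K 1 q 1).of_restrictsTo (tensorRestrictsTo_cwComp011 K q)

/-- `T_{101} ≥ ⟨1,1,q⟩`: one product of format `(1,1,q)`. [cite: CoppersmithWinograd1990, §7 eq. (10)] -/
theorem hasFormatValue_cwComp101 : HasFormatValue (cwComp K q 1 0 1) 1 1 1 q := by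
  simpa using (hasFormatValue_matMulTensor K 1 1 q).of_restrictsTo (tensorRestrictsTo_cwComp101 K q)

/-- `T_{110} ≥ ⟨q,1,1⟩`: one product of format `(q,1,1)`. [cite: CoppersmithWinograd1990, §7 eq. (10)] -/
theorem hasFormatValue_cwComp110 : HasFormatValue (cwComp K q 1 1 0) 1 q 1 1 := by
  simpa using (hasFormatValue_matMulTensor K q 1 1).of_restrictsTo (tensorRestrictsTo_cwComp110 K q)

/-- `T_{002} ≥ ⟨1,1,1⟩`. [cite: CoppersmithWinograd1990, §7 eq. (10)] -/
theorem hasFormatValue_cwComp002 : HasFormatValue (cwComp K q 0 0 2) 1 1 1 1 := by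
  simpa using (hasFormatValue_matMulTensor K 1 1 1).of_restrictsTo (tensorRestrictsTo_cwComp002 K q)

/-- `T_{020} ≥ ⟨1,1,1⟩`. [cite: CoppersmithWinograd1990, §7 eq. (10)] -/
theorem hasFormatValue_cwComp020 : HasFormatValue (cwComp K q 0 2 0) 1 1 1 1 := by
  simpa using (hasFormatValue_matMulTensor K 1 1 1).of_restrictsTo (tensorRestrictsTo_cwComp020 K q)

/-- `T_{200} ≥ ⟨1,1,1⟩`. [cite: CoppersmithWinograd1990, §7 eq. (10)] -/
theorem hasFormatValue_cwComp200 : HasFormatValue (cwComp K q 2 0 0) 1 1 1 1 := by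
  simpa using (hasFormatValue_matMulTensor K 1 1 1).of_restrictsTo (tensorRestrictsTo_cwComp200 K q)

end LevelOne

/-! ## The four pair components of `[112]` and their formats -/

section Pairs

variable (K : Type u) [Field K] (q : ℕ)

/-- **First format of the pair components**: `1` on the two products with `z`-label `(1,1)`
(`T_{101}⊗T_{011}`, `T_{011}⊗T_{101}`, format `(1,q,q)`), `q` on the other two
(`T_{110}⊗T_{002}`, `T_{002}⊗T_{110}`, format `(q,1,1)`). [cite: Coppersmith1997, §3] -/
def cwF112A (s : PL × PL × PL) : ℝ := if s.2.2 = (1, 1) then 1 else (q : ℝ)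

/-- **Second (= third) format of the pair components**: `q` on the products with `z`-label
`(1,1)`, `1` on the other two. [cite: Coppersmith1997, §3] -/
def cwF112B (s : PL × PL × PL) : ℝ := if s.2.2 = (1, 1) then (q : ℝ) else 1

/-- The values of the format data on the four pairs. [folklore] -/
private theorem cwF112_values :
    cwF112A q ((1, 0), (1, 0), (0, 2)) = q ∧ cwF112A q ((0, 1), (0, 1), (2, 0)) = q ∧
    cwF112A q ((1, 0), (0, 1), (1, 1)) = 1 ∧ cwF112A q ((0, 1), (1, 0), (1, 1)) = 1 ∧
    cwF112B q ((1, 0), (1, 0), (0, 2)) = 1 ∧ cwF112B q ((0, 1), (0, 1), (2, 0)) = 1 ∧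
    cwF112B q ((1, 0), (0, 1), (1, 1)) = q ∧ cwF112B q ((0, 1), (1, 0), (1, 1)) = q := by
  refine ⟨?_, ?_, ?_, ?_, ?_, ?_, ?_, ?_⟩ <;> simp [cwF112A, cwF112B]

/-- `cwF112A > 0`. [folklore] -/
private theorem cwF112A_pos (hq : 1 ≤ q) (s : PL × PL × PL) : 0 < cwF112A q s := by
  have : (0 : ℝ) < q := by exact_mod_cast hq
  simp only [cwF112A]; split_ifs <;> positivity

/-- `cwF112B > 0`. [folklore] -/
private theorem cwF112B_pos (hq : 1 ≤ q) (s : PL × PL × PL) : 0 < cwF112B q s := by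
  have : (0 : ℝ) < q := by exact_mod_cast hq
  simp only [cwF112B]; split_ifs <;> positivity

/-- **The format values of the four products** (`HasFormatValue.kronecker` from the level-1
formats): each pair component is worth one product of format `(cwF112A, cwF112B, cwF112B)`.
[cite: Coppersmith1997, §3] [cite: CoppersmithWinograd1990, §8] -/
theorem hasFormatValue_cwS112 (s : PL × PL × PL) (hs : s ∈ cwS112) :
    HasFormatValue (partSubtensor cwPairLev cwPairLev cwPairLev (cwSqComp K q 1 1 2)
      {s.1} {s.2.1} {s.2.2}) 1 (cwF112A q s) (cwF112B q s) (cwF112B q s) := by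
  have hq0 : (0 : ℝ) ≤ q := Nat.cast_nonneg q
  obtain ⟨a1, a2, a3, a4, b1, b2, b3, b4⟩ := cwF112_values q
  simp only [cwS112, Finset.mem_insert, Finset.mem_singleton] at hs
  rcases hs with rfl | rfl | rfl | rfl
  · rw [a1, b1, cwSqComp_pair, if_pos (by refine ⟨?_, ?_, ?_⟩ <;> ext <;> simp)]
    have h := (hasFormatValue_cwComp110 K q).kronecker (hasFormatValue_cwComp002 K q) zero_le_one
      zero_le_one hq0 zero_le_one zero_le_one zero_le_one zero_le_one zero_le_one
    simpa using h
  · rw [a2, b2, cwSqComp_pair, if_pos (by refine ⟨?_, ?_, ?_⟩ <;> ext <;> simp)]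
    have h := (hasFormatValue_cwComp002 K q).kronecker (hasFormatValue_cwComp110 K q) zero_le_one
      zero_le_one zero_le_one hq0 zero_le_one zero_le_one zero_le_one zero_le_one
    simpa using h
  · rw [a3, b3, cwSqComp_pair, if_pos (by refine ⟨?_, ?_, ?_⟩ <;> ext <;> simp)]
    have h := (hasFormatValue_cwComp101 K q).kronecker (hasFormatValue_cwComp011 K q) zero_le_one
      zero_le_one zero_le_one zero_le_one zero_le_one hq0 hq0 zero_le_one
    simpa using h
  · rw [a4, b4, cwSqComp_pair, if_pos (by refine ⟨?_, ?_, ?_⟩ <;> ext <;> simp)]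
    have h := (hasFormatValue_cwComp011 K q).kronecker (hasFormatValue_cwComp101 K q) zero_le_one
      zero_le_one zero_le_one zero_le_one hq0 zero_le_one zero_le_one hq0
    simpa using h

end Pairs

/-! ## The inner laser step: the format value of `[112]` -/

section Value

variable (K : Type u) [Field K] (q : ℕ)

/-- **The counts of the rational splitting `σ = a/d`**: `a` on each `(1,q,q)`-product, `d − a` on
each `(q,1,1)`-product (common denominator `2d`; `cwP112 (a/d) = cwC112 a d / (2d)`).
[cite: CoppersmithWinograd1990, §8] -/
def cwC112 (a d : ℕ) (s : PL × PL × PL) : ℕ :=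
  if s ∈ cwS112 then (if s.2.2 = (1, 1) then a else d - a) else 0

/-- The four counts. [folklore] -/
private theorem cwC112_values (a d : ℕ) :
    cwC112 a d ((1, 0), (1, 0), (0, 2)) = d - a ∧ cwC112 a d ((0, 1), (0, 1), (2, 0)) = d - a ∧
    cwC112 a d ((1, 0), (0, 1), (1, 1)) = a ∧ cwC112 a d ((0, 1), (1, 0), (1, 1)) = a := by
  refine ⟨?_, ?_, ?_, ?_⟩ <;> simp [cwC112, cwS112]

/-- `cwC112` vanishes off `cwS112`. [folklore] -/
private theorem cwC112_eq_zero (a d : ℕ) (s : PL × PL × PL) (hs : s ∉ cwS112) : cwC112 a d s = 0 := by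
  simp [cwC112, hs]

/-- `∑ cwC112 a d = 2d` (for `a ≤ d`). [folklore] -/
private theorem sum_cwC112 {a d : ℕ} (had : a ≤ d) : ∑ s, cwC112 a d s = 2 * d := by
  rw [← Finset.sum_subset (Finset.subset_univ cwS112) (fun s _ hs => cwC112_eq_zero a d s hs)]
  obtain ⟨e1, e2, e3, e4⟩ := cwC112_values a d
  simp only [cwS112]
  rw [Finset.sum_insert (by decide), Finset.sum_insert (by decide), Finset.sum_insert (by decide),
    Finset.sum_singleton, e1, e2, e3, e4]
  omega

/-- `cwP112 (a/d) = cwC112 a d / (2d)`. [folklore] -/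
private theorem cwP112_eq_cwC112_div {a d : ℕ} (had : a ≤ d) (hd : 0 < d) {σ : ℝ} (hσ : σ = (a : ℝ) / d)
    (s : PL × PL × PL) : cwP112 σ s = (cwC112 a d s : ℝ) / ((2 * d : ℕ) : ℝ) := by
  have hd0 : (d : ℝ) ≠ 0 := by exact_mod_cast hd.ne'
  by_cases hs : s ∈ cwS112
  · simp only [cwP112, cwC112, if_pos hs]
    split_ifs
    · rw [hσ]; push_cast; field_simp
    · rw [hσ]; push_cast [Nat.cast_sub had]; field_simp
  · simp [cwP112, cwC112, hs]

/-- **Coppersmith 1997 §3 / Coppersmith–Winograd 1990 §8 in format currency: the format value of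
`[112]`.**  For `q ≥ 1` and a rational splitting `σ = a/d ∈ (0,1)`, the component `T^{[112]}` of
`CW_q^{⊗2}` is worth `2^{min(1, H_Z(σ))}` independent products of format `(q^{1−σ}, q^σ, q^σ)`,
`H_Z(σ) = (2η((1−σ)/2) + η(σ))/ln 2` — the inner laser step `laserMethod_hasFormatValue_of_counts`
on the pair decomposition `cwS112` (tight, `Γ = 0`, marginal entropies `1, 1, H_Z(σ)`) with the pair
formats `hasFormatValue_cwS112`. [cite: Coppersmith1997, §3] [cite: CoppersmithWinograd1990, §8]
[cite: LeGall2014, Thm. 4.1] -/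
theorem hasFormatValue_cwSqComp112 (hq : 1 ≤ q) {a d : ℕ} (ha : 0 < a) (had : a < d) {σ : ℝ}
    (hσ : σ = (a : ℝ) / d) :
    HasFormatValue (cwSqComp K q 1 1 2)
      ((2 : ℝ) ^ min 1 ((2 * negMulLog ((1 - σ) / 2) + negMulLog σ) / Real.log 2))
      ((q : ℝ) ^ (1 - σ)) ((q : ℝ) ^ σ) ((q : ℝ) ^ σ) := by
  have hd : 0 < d := lt_of_le_of_lt (Nat.zero_le a) had
  have hd0 : (0 : ℝ) < d := by exact_mod_cast hd
  have h0 : 0 < σ := by rw [hσ]; positivity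
  have h1 : σ < 1 := by rw [hσ, div_lt_one hd0]; exact_mod_cast had
  have hq0 : (0 : ℝ) < (q : ℕ) := by exact_mod_cast hq
  have hv : ∀ s ∈ cwS112, (0 : ℝ) < (fun _ : PL × PL × PL => (1 : ℝ)) s := fun _ _ => one_pos
  have hfA : ∀ s ∈ cwS112, 0 < cwF112A q s := fun s _ => cwF112A_pos q hq s
  have hfB : ∀ s ∈ cwS112, 0 < cwF112B q s := fun s _ => cwF112B_pos q hq s
  have h := laserMethod_hasFormatValue_of_counts (cwSqComp K q 1 1 2) cwPairLev cwPairLev cwPairLev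
    cwS112 (cwSqComp112_support K q) cwTight112 cwTight112 cwTight112γ cwTight112_injective
    cwTight112_injective cwTight112γ_injective cwTight112_bound cwTight112_bound cwTight112_sum
    (fun _ => (1 : ℝ)) (cwF112A q) (cwF112B q) (cwF112B q) hv hfA hfB hfB
    (fun s hs => hasFormatValue_cwS112 K q s hs) (cwC112 a d) (cwC112_eq_zero a d)
    (by omega : 0 < 2 * d) (sum_cwC112 had.le) (cwP112 σ) (cwP112_eq_cwC112_div had.le hd hσ)
  rw [shannonEntropy_marginalDist₁_cwP112, shannonEntropy_marginalDist₂_cwP112,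
    shannonEntropy_marginalDist₃_cwP112, maxEntropyPenalty_cwP112 σ h0 h1, sub_zero] at h
  -- the products of the data over the four pairs
  obtain ⟨e1, e2, e3, e4⟩ := cwP112_values σ
  obtain ⟨a1, a2, a3, a4, b1, b2, b3, b4⟩ := cwF112_values q
  have hprodv : ∏ s ∈ cwS112, (fun _ : PL × PL × PL => (1 : ℝ)) s ^ cwP112 σ s = 1 :=
    Finset.prod_eq_one fun s _ => Real.one_rpow _
  have hprodA : ∏ s ∈ cwS112, cwF112A q s ^ cwP112 σ s = (q : ℝ) ^ (1 - σ) := by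
    simp only [cwS112]
    rw [Finset.prod_insert (by decide), Finset.prod_insert (by decide),
      Finset.prod_insert (by decide), Finset.prod_singleton, e1, e2, e3, e4, a1, a2, a3, a4]
    simp only [Real.one_rpow, mul_one]
    rw [← Real.rpow_add hq0]
    ring_nf
  have hprodB : ∏ s ∈ cwS112, cwF112B q s ^ cwP112 σ s = (q : ℝ) ^ σ := by
    simp only [cwS112]
    rw [Finset.prod_insert (by decide), Finset.prod_insert (by decide),
      Finset.prod_insert (by decide), Finset.prod_singleton, e1, e2, e3, e4, b1, b2, b3, b4]
    simp only [Real.one_rpow, one_mul]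
    rw [← Real.rpow_add hq0]
    ring_nf
  rw [hprodv, hprodA, hprodB, mul_one, ← min_assoc, min_self] at h
  exact h

/-- The format value of `[121] = [112]_C`: format `(q^σ, q^σ, q^{1−σ})`. [cite: Coppersmith1997, §3] -/
theorem hasFormatValue_cwSqComp121 (hq : 1 ≤ q) {a d : ℕ} (ha : 0 < a) (had : a < d) {σ : ℝ}
    (hσ : σ = (a : ℝ) / d) :
    HasFormatValue (cwSqComp K q 1 2 1)
      ((2 : ℝ) ^ min 1 ((2 * negMulLog ((1 - σ) / 2) + negMulLog σ) / Real.log 2))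
      ((q : ℝ) ^ σ) ((q : ℝ) ^ σ) ((q : ℝ) ^ (1 - σ)) := by
  rw [cwSqComp_rotate K q 1 1 2]
  exact (hasFormatValue_cwSqComp112 K q hq ha had hσ).rotate_modes

/-- The format value of `[211] = [121]_C`: format `(q^σ, q^{1−σ}, q^σ)`. [cite: Coppersmith1997, §3] -/
theorem hasFormatValue_cwSqComp211 (hq : 1 ≤ q) {a d : ℕ} (ha : 0 < a) (had : a < d) {σ : ℝ}
    (hσ : σ = (a : ℝ) / d) :
    HasFormatValue (cwSqComp K q 2 1 1)
      ((2 : ℝ) ^ min 1 ((2 * negMulLog ((1 - σ) / 2) + negMulLog σ) / Real.log 2))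
      ((q : ℝ) ^ σ) ((q : ℝ) ^ (1 - σ)) ((q : ℝ) ^ σ) := by
  rw [cwSqComp_rotate K q 1 2 1]
  exact (hasFormatValue_cwSqComp121 K q hq ha had hσ).rotate_modes

end Value

end Literature.Computability.AlgebraicComplexity

end
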